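/-
Copyright (c) 2026 the pub-hodgecm-mathlib formalisation cell (harness21).  Prover seat hodgecm-mathlib-F0P2-p01 (g15): road «S3-ram» (LEAD F0P3a-plan (g12∕g13); architect
A-p16 (g32); junction pen F0P3a-p01 (g17), J-PACK v2 assembly lemma L2 «orientation of rows», first half; owner F0P3a-p06 (g15)); 2026-09-02.
-/
import Literature.NumberTheory.Automorphic.UnitaryLatticeTreeFixedRowRankOneRamified       -- ★ ROW-P p847551 (this seat; brings ★ ROW-E p847526)
import Literature.NumberTheory.Automorphic.UnitaryLatticeTreeFixedRowLeafRamified          -- ★ ROW-C p847560 (this seat)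
import Literature.NumberTheory.Automorphic.UnitaryLatticeTreeFixedRowOddRamified           -- ★ ROW-O (F0P2-p06 (g13))
import Literature.NumberTheory.Automorphic.UnitaryLatticeTreeFixedRowRegularRamified       -- ★ ROW-R (F0P3-p03 (g15))
import Literature.NumberTheory.Automorphic.UnitaryLatticeTreeRankOneVertexOneClassRamified -- ★ ROW-1C p847514 (F0P3a-p05 (g17))
import Literature.NumberTheory.Automorphic.UnitaryLatticeTreeFixedVertex                 -- ★ `scaleLattice_scaleLattice`, `scaleLattice_mono`, `scaleLattice_le_self_of_v_le_one`
import HarnessLib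

/-!
# The lattice graph of a hermitian space — DEPTHS STRICTLY DECREASE DOWN THE FIXED TREE (tame-ramified place): the fixed grandchildren of an oriented fixed vertex of
# exact depth `d ≥ 1` are NOT of level `ϖ^d` (Bruhat–Tits 1972 §10; Tits 1979 §3.5; Kottwitz 1986 §3)

Topic `NumberTheory/Automorphic`; namespace `Literature.NumberTheory.Automorphic.UnitaryLatticeTree`.  THEOREMS ONLY (no definition, no instance, no notation, no named fact,
no `sorry`); kernel lane `--supports stmt-HodgeConjecture-24833`.  Cell `pub/hodgecm-mathlib` (D-0151), crux H413; road «S3-ram» (Literature seeding, count-neutral), organ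
A′ (ii) of the P-1-ram skeleton; junction J-PACK v2 (F0P3a-p01 (g17)), assembly lemma **L2 `orientation_of_rows`** (skeleton v4 :309, allotted to this seat by A-p16 (g32)
01:34:50Z) — THIS FILE is its inductive step's engine: «CHILDREN ARE STRICTLY SHALLOWER».  J₀-MODEL, token currency.

THE STATEMENT.  For a fixed self-dual vertex `v ≠ r₀` of EXACT depth `d ≥ 1` (`LEV[v](ϖ^d)`, `¬LEV[v](ϖ^{d+1})`), residually nilpotent (`LEV₃[v](ϖ^{3d+1})`), ORIENTED
(`p` the inward neighbour, `g ≠ v` through `p` with `LEV[g](ϖ^d)`), and any unit `c₁` and non-square unit datum `ε` (only used to name a class in the rank-one case):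
**every fixed grandchild `w ∈ GC(v)` has `¬LEV[w](ϖ^d)`** — whatever the rank and parity of `v`.  With ★ `fixedGrandchildren_eq_empty_of_levelZero` (depth `0`, F0P2-p06)
and ★ `rootGrandchildLabels_equilateral` (the root, F0P3a-p04) this is the «levels strictly decrease away from the root» half of L2; the other half is the rooted-tree
bookkeeping (★ `exists_rooted_parent`, ★ `parentClosed_fixedPoints`, alternation).

THE PROOF (case split on the rank token `LEV₂[v](ϖ^{2d+1})` and the parity of `d`, each case a ★ ROW by name):
rank two & `d` even ⇒ ★ ROW-E (`¬LEV[w](ϖ^d)` verbatim); rank two & `d = 1` ⇒ ★ ROW-R (`¬LEV[w] ϖ`); rank two & `d ≥ 3` odd ⇒ ★ ROW-O with `c := 1` (either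
`¬LEV[w](ϖ^d)` or `¬LEV[w](ϖ^{d−1})`, and LEV is monotone); rank `≤ 1` & `d` even ⇒ impossible (★ I `map_sub_one_latt_le_scaleLattice_succ_of_even` contradicts exact depth);
rank `≤ 1` & `d = 1` ⇒ ★ ROW-C (`GC(v) = ∅`); rank `≤ 1` & `d ≥ 3` odd ⇒ ★ ROW-1C names the class (`c₁` or `c₁ε`) and ★ ROW-P gives `¬LEV[w](ϖ^{d−1})`.

* `lev_mono_of_le` (LEV is monotone in the exponent), **`not_lev_of_mem_fixedGrandchildren`**.

HONEST LABEL: HC_CM is proved only modulo the 2 remaining named inputs (hLiu418 24832, h413 24833) until rung 0 closes; nothing printed is asserted here (elementary lattice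
bookkeeping over a valuation ring); «S3-ram» has no books consequence.

## References
* [BruhatTits1972] F. Bruhat, J. Tits, *Groupes réductifs sur un corps local I*, Publ. Math. IHÉS 41 (1972), §10 (lattice models; vertex stabilisers and their filtrations).
* [Tits1979] J. Tits, *Reductive groups over local fields*, PSPM 33.1 (1979), §3.5 (congruence filtration; reduction mod `𝔭`).
* [Kottwitz1986] R. E. Kottwitz, *Base change for unit elements of Hecke algebras*, Compositio Math. 60 (1986), §3 (counting fixed lattices shell by shell).
* [Serre1980Trees] J.-P. Serre, *Trees* (1980), Ch. II §1.1 (neighbours of a lattice = lines of its reduction; balls in the tree).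
-/

set_option autoImplicit false

noncomputable section

open scoped Valued WithZero Matrix MatrixGroups

namespace Literature.NumberTheory.Automorphic.UnitaryLatticeTree

open Literature.NumberTheory.Automorphic Literature.NumberTheory.Automorphic.HermitianLattice

variable {K : Type*} [Field K] [Valued K ℤᵐ⁰] {σ : K →+* K} {ϖ : K}

/-- **LEV is monotone in the exponent**: `(γ−1)M ⊆ ϖ^{e′}M ⇒ (γ−1)M ⊆ ϖ^e M` for `e ≤ e′` (`|ϖ| ≤ 1`). [cite: Serre1980Trees, II.1.1] -/
theorem lev_mono_of_le (hϖ1 : Valued.v ϖ ≤ 1) {γ : unitaryGroupOfForm σ ((StdForm.antidiagonal 3).over K)} {w : {M : Submodule 𝒪[K] (Fin 3 → K) // IsVertex σ ϖ ((StdForm.antidiagonal 3).over K) M}} {e e' : ℕ} (h : e ≤ e')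
    (hlev : w.1.map ((Matrix.toLin' (((γ : GL (Fin 3) K) : Matrix (Fin 3) (Fin 3) K) - 1)).restrictScalars 𝒪[K]) ≤ scaleLattice (ϖ ^ e') w.1) :
    w.1.map ((Matrix.toLin' (((γ : GL (Fin 3) K) : Matrix (Fin 3) (Fin 3) K) - 1)).restrictScalars 𝒪[K]) ≤ scaleLattice (ϖ ^ e) w.1 := by
  refine hlev.trans ?_
  obtain ⟨t, rfl⟩ := Nat.exists_eq_add_of_le h
  rw [pow_add, ← scaleLattice_scaleLattice (ϖ ^ e) (ϖ ^ t) w.1]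
  refine scaleLattice_mono _ (scaleLattice_le_self_of_v_le_one ?_ _)
  rw [map_pow]; exact pow_le_one₀ zero_le hϖ1

/-- **CHILDREN ARE STRICTLY SHALLOWER** (the inductive engine of the junction's L2 `orientation_of_rows`): for a fixed self-dual vertex `v ≠ r₀` of exact depth `d ≥ 1`,
residually nilpotent and oriented by `(p, g, hup)`, every fixed grandchild `w ∈ GC(v)` satisfies `¬LEV[w](ϖ^d)` (★ ROW-E ∕ ROW-R ∕ ROW-O ∕ ROW-C ∕ ROW-1C+ROW-P ∕ ★ I by
rank and parity). [cite: Kottwitz1986, §3] [cite: Tits1979, §3.5] [cite: BruhatTits1972, §10] [cite: Serre1980Trees, II.1.1] -/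
theorem not_lev_of_mem_fixedGrandchildren (hσ : ∀ x, σ (σ x) = x) (hvσ : ∀ a, Valued.v (σ a) = Valued.v a) (hσϖ : σ ϖ = -ϖ)
    (hϖ : Valued.v ϖ = WithZero.exp (-1 : ℤ)) (hres : ∀ x : K, Valued.v x ≤ 1 → Valued.v (σ x - x) < 1) (h2 : Valued.v (2 : K) = 1) [Finite 𝓀[K]]
    (hT : (latticeGraph σ ϖ ((StdForm.antidiagonal 3).over K)).IsTree)
    {γ : unitaryGroupOfForm σ ((StdForm.antidiagonal 3).over K)} (hγ0 : γ ∈ unitaryInt σ ((StdForm.antidiagonal 3).over K))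
    {v : {M : Submodule 𝒪[K] (Fin 3 → K) // IsVertex σ ϖ ((StdForm.antidiagonal 3).over K) M}}
    (hv : IsSelfDualLattice σ ϖ ((StdForm.antidiagonal 3).over K) v.1) (hvr : v ≠ ⟨stdLattice K 3, 0, isSelfDualLattice_stdLattice_three_of_v hϖ⟩)
    (hfix : latticeGraphIso σ ϖ ((StdForm.antidiagonal 3).over K) γ v = v)
    {d : ℕ} (hd1 : 1 ≤ d)
    {p g : {M : Submodule 𝒪[K] (Fin 3 → K) // IsVertex σ ϖ ((StdForm.antidiagonal 3).over K) M}}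
    (hp : (latticeGraph σ ϖ ((StdForm.antidiagonal 3).over K)).Adj v p)
    (hpin : (latticeGraph σ ϖ ((StdForm.antidiagonal 3).over K)).dist ⟨stdLattice K 3, 0, isSelfDualLattice_stdLattice_three_of_v hϖ⟩ p + 1 =
      (latticeGraph σ ϖ ((StdForm.antidiagonal 3).over K)).dist ⟨stdLattice K 3, 0, isSelfDualLattice_stdLattice_three_of_v hϖ⟩ v)
    (hg : (latticeGraph σ ϖ ((StdForm.antidiagonal 3).over K)).Adj p g) (hgv : g ≠ v)
    (hup : g.1.map ((Matrix.toLin' (((γ : GL (Fin 3) K) : Matrix (Fin 3) (Fin 3) K) - 1)).restrictScalars 𝒪[K]) ≤ scaleLattice (ϖ ^ d) g.1)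
    (hlev : v.1.map ((Matrix.toLin' (((γ : GL (Fin 3) K) : Matrix (Fin 3) (Fin 3) K) - 1)).restrictScalars 𝒪[K]) ≤ scaleLattice (ϖ ^ d) v.1)
    (hexact : ¬ v.1.map ((Matrix.toLin' (((γ : GL (Fin 3) K) : Matrix (Fin 3) (Fin 3) K) - 1)).restrictScalars 𝒪[K]) ≤ scaleLattice (ϖ ^ (d + 1)) v.1)
    (hnil : v.1.map ((Matrix.toLin' ((((γ : GL (Fin 3) K) : Matrix (Fin 3) (Fin 3) K) - 1) ^ 3)).restrictScalars 𝒪[K]) ≤ scaleLattice (ϖ ^ (3 * d + 1)) v.1)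
    (c₁ ε : K) (hc₁ : Valued.v c₁ = 1) (hεv : Valued.v ε = 1) (hε : ∀ z : K, Valued.v z ≤ 1 → Valued.v (z ^ 2 - ε) = 1) :
    ∀ w ∈ {w | ∃ c, ((latticeGraph σ ϖ ((StdForm.antidiagonal 3).over K)).Adj v c ∧
          (latticeGraph σ ϖ ((StdForm.antidiagonal 3).over K)).dist ⟨stdLattice K 3, 0, isSelfDualLattice_stdLattice_three_of_v hϖ⟩ c =
            (latticeGraph σ ϖ ((StdForm.antidiagonal 3).over K)).dist ⟨stdLattice K 3, 0, isSelfDualLattice_stdLattice_three_of_v hϖ⟩ v + 1 ∧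
          latticeGraphIso σ ϖ ((StdForm.antidiagonal 3).over K) γ c = c) ∧
        ((latticeGraph σ ϖ ((StdForm.antidiagonal 3).over K)).Adj c w ∧
          (latticeGraph σ ϖ ((StdForm.antidiagonal 3).over K)).dist ⟨stdLattice K 3, 0, isSelfDualLattice_stdLattice_three_of_v hϖ⟩ w =
            (latticeGraph σ ϖ ((StdForm.antidiagonal 3).over K)).dist ⟨stdLattice K 3, 0, isSelfDualLattice_stdLattice_three_of_v hϖ⟩ c + 1 ∧
          latticeGraphIso σ ϖ ((StdForm.antidiagonal 3).over K) γ w = w)},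
      ¬ w.1.map ((Matrix.toLin' (((γ : GL (Fin 3) K) : Matrix (Fin 3) (Fin 3) K) - 1)).restrictScalars 𝒪[K]) ≤ scaleLattice (ϖ ^ d) w.1 := by
  have hϖ1 : Valued.v ϖ ≤ 1 := by rw [hϖ, ← WithZero.exp_zero]; exact WithZero.exp_le_exp.2 (by norm_num)
  intro w hw
  by_cases hrk : v.1.map ((Matrix.toLin' ((((γ : GL (Fin 3) K) : Matrix (Fin 3) (Fin 3) K) - 1) ^ 2)).restrictScalars 𝒪[K]) ≤ scaleLattice (ϖ ^ (2 * d + 1)) v.1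
  · -- RANK ≤ 1
    rcases Nat.even_or_odd d with hde | hdo
    · -- even depth and rank ≤ 1 contradict exact depth (★ I)
      exfalso
      obtain ⟨u, hu⟩ := exists_latticeGraphIso_root_eq_of_v_two hσ hvσ hϖ h2 v hv (isSelfDualLattice_stdLattice_three_of_v hϖ)
      subst hu
      exact hexact (map_sub_one_latt_le_scaleLattice_succ_of_even hvσ hσϖ hϖ hres h2 u γ hde hd1 hlev hrk)
    · have hd13 : d = 1 ∨ 3 ≤ d := by obtain ⟨m, hm⟩ := hdo; omega
      rcases hd13 with rfl | hd3
      · -- `d = 1`, rank one: ★ ROW-C, no fixed grandchildren at all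
        have hup' : g.1.map ((Matrix.toLin' (((γ : GL (Fin 3) K) : Matrix (Fin 3) (Fin 3) K) - 1)).restrictScalars 𝒪[K]) ≤ scaleLattice (ϖ) g.1 := by rw [pow_one] at hup; exact hup
        have hlev' : v.1.map ((Matrix.toLin' (((γ : GL (Fin 3) K) : Matrix (Fin 3) (Fin 3) K) - 1)).restrictScalars 𝒪[K]) ≤ scaleLattice (ϖ) v.1 := by rw [pow_one] at hlev; exact hlev
        have hempty := fixedGrandchildren_eq_empty_of_rankOne_depthOne hσ hvσ hσϖ hϖ hres h2 hT hγ0 hv hvr hfix hp hpin hg hgv hup' hlev' hexact hrk hnil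
        rw [hempty] at hw
        exact absurd hw (Set.notMem_empty w)
      · -- `d ≥ 3` odd, rank one: ★ ROW-1C names the class, ★ ROW-P gives `¬LEV[w](ϖ^(d−1))`
        have h1C := (class_xor_class_mul_of_fixed_selfDual_rankOne hσ hvσ hσϖ hϖ hres h2 hγ0 hv hfix hd1 hlev hexact hrk hnil c₁ ε hc₁ hεv hε).1
        have hc₁ε : Valued.v (c₁ * ε) = 1 := by rw [map_mul, hc₁, hεv, one_mul]
        intro h
        rcases h1C with hcls | hcls
        · exact ((fixedGrandchildren_tokens_and_ncard_of_rankOne hσ hvσ hσϖ hϖ hres h2 hT hγ0 hv hvr hfix hd3 hdo hp hpin hg hgv hup hlev hexact hrk hnil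
            c₁ hc₁ hcls).1 w hw).2.1 (lev_mono_of_le hϖ1 (Nat.sub_le d 1) h)
        · exact ((fixedGrandchildren_tokens_and_ncard_of_rankOne hσ hvσ hσϖ hϖ hres h2 hT hγ0 hv hvr hfix hd3 hdo hp hpin hg hgv hup hlev hexact hrk hnil
            (c₁ * ε) hc₁ε hcls).1 w hw).2.1 (lev_mono_of_le hϖ1 (Nat.sub_le d 1) h)
  · -- RANK 2
    rcases Nat.even_or_odd d with hde | hdo
    · -- even depth: ★ ROW-E
      have hd2 : 2 ≤ d := by obtain ⟨m, rfl⟩ := hde; omega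
      exact ((fixedGrandchildren_tokens_and_ncard_of_even hσ hvσ hσϖ hϖ hres h2 hT hγ0 hv hvr hfix hd2 hde hp hpin hg hgv hup hlev hexact hrk hnil).1 w hw).2.1
    · have hd13 : d = 1 ∨ 3 ≤ d := by obtain ⟨m, hm⟩ := hdo; omega
      rcases hd13 with rfl | hd3
      · -- `d = 1`, rank two: ★ ROW-R
        have hup' : g.1.map ((Matrix.toLin' (((γ : GL (Fin 3) K) : Matrix (Fin 3) (Fin 3) K) - 1)).restrictScalars 𝒪[K]) ≤ scaleLattice (ϖ) g.1 := by rw [pow_one] at hup; exact hup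
        have hlev' : v.1.map ((Matrix.toLin' (((γ : GL (Fin 3) K) : Matrix (Fin 3) (Fin 3) K) - 1)).restrictScalars 𝒪[K]) ≤ scaleLattice (ϖ) v.1 := by rw [pow_one] at hlev; exact hlev
        have h := (fixedGrandchildren_not_lev_and_ncard_of_regular_one hσ hvσ hσϖ hϖ hres h2 hT hγ0 hv hvr hfix hp hpin hg hgv hup' hlev' hexact hrk hnil).1 w hw
        rw [pow_one]; exact h
      · -- `d ≥ 3` odd, rank two: ★ ROW-O (class constant `1`)
        rcases (fixedGrandchildren_tokens_and_ncard_of_odd hσ hvσ hσϖ hϖ hres h2 hT hγ0 hv hvr hfix hd3 hdo hp hpin hg hgv hup hlev hexact hrk hnil 1 (map_one _)).1 w hw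
          with hE | hC
        · exact hE.2.1
        · exact fun h => hC.2.1 (lev_mono_of_le hϖ1 (Nat.sub_le d 1) h)

end Literature.NumberTheory.Automorphic.UnitaryLatticeTree

end
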